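import Summits.QuantumFields.QCD.Theses.HeatSlicedQuarks
import Summits.QuantumFields.QCD.Theorems.HeatSlicedQuarksTracedQuadraticParametrixDerivativeColumnIdentificationAux
import Summits.QuantumFields.QCD.Theorems.HeatSlicedQuarksTracedQuadraticParametrixFreeTimeDerivativeProfile
import Summits.QuantumFields.QCD.Theorems.HeatSlicedQuarksInterleavedHeatSliceFlowParametrixDiagonalLog

/-!
# Stub `stub_derivativeColumnIdentification` of line `Sketch` — column inputs
(crux `TracedQuadraticParametrix`, item stmt-QuantumFields-17985; lead prover-line-stmt-QuantumFields-17985-0)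

The three column-level inputs of the derivative column law, packaged once for all times:

* `weighted_free_col_diff_le` / `hopping_col_lipschitz` — the TIME-LIPSCHITZ MODULUS of the hopping perturbation applied to
  the free column, `‖E(K_1(u) − K_1(s))e_{(x,a,α)}‖₂ ≤ δA₃ (s−u)/((1+s/2)√(1+s/2))` for `u ∈ [s/2, s]`: FTC
  `K_1(u) − K_1(s) = ∫_u^s H_1K_1(v)dv` (landed `stub_rowDuhamel`), Minkowski with the `(d+3)²`-weights of the landed
  `stub_hoppingWeightedBounds`, the landed free time-derivative profile `stub_freeTimeDerivativeProfile` (p136346) and the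
  landed moments `stub_freeWeightedMoments` — this is what the maximal-regularity step consumes;
* `hopping_col_l1_bound` — the `ℓ¹` bound `‖EᴴD_1K_1(σ)e_{(x,a,α)}‖₁ ≤ δA₂` (as in the landed `stub_columnIdentification`);
* `deriv_col_sup` — the `ℓ¹ → ℓ²` size of one Dirac factor on the interacting kernel under global smallness,
  `‖D_W K_W(σ) e_q‖₂ ≤ √(C₉/(eσ³))` for `1 ≤ σ ≤ r²` (spectral gain `sum_norm_sq_col_mul_exp_le` + the closed crux 8871 at
  every site).
-/

noncomputable section

namespace Summit.QuantumFields.QCD.Cruxes.TracedQuadraticParametrix.Sketch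

open Literature.MathematicalPhysics.QuantumLattice Literature.MathematicalPhysics.QuantumFieldTheory
  Literature.Probability.LatticeModels
open Summit.QuantumFields.QCD.Theses.HeatSlicedQuarks
open Summit.QuantumFields.QCD.Cruxes.InterleavedHeatSliceFlow.Sketch
open Summit.QuantumFields.QCD.Theorems.SmallFieldUltracontractivity.Negative
open Summit.QuantumFields.QCD.Cruxes.SmallFieldUltracontractivity.PointCentredAxialParabolic
open MeasureTheory intervalIntegral
open scoped Matrix ComplexConjugate

variable {L : ℕ} [NeZero L]

/-! ### The time-Lipschitz modulus of the weighted free column -/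

/-- **FTC for the free column**: `(K_1(u) − K_1(s'))(q,p₀) = ∫_u^{s'} (H_1 K_1(τ))(q,p₀) dτ` for every Hermitian generator
written as `BᴴB` (landed `stub_rowDuhamel` with trivial left kernel and weight). -/
theorem free_col_diff_eq_integral {ι : Type} [Fintype ι] [DecidableEq ι] (B : Matrix ι ι ℂ) {u s' : ℝ} (hus : u ≤ s')
    (q p₀ : ι) :
    (NormedSpace.exp (-(u : ℂ) • (Bᴴ * B)) - NormedSpace.exp (-(s' : ℂ) • (Bᴴ * B))) q p₀ =
      ∫ τ in u..s', ((Bᴴ * B) * NormedSpace.exp (-(τ : ℂ) • (Bᴴ * B))) q p₀ := by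
  have h := stub_rowDuhamel ι (0 : Matrix ι ι ℂ) (Bᴴ * B) 1 (fun _ => (1 : ℝ)) (fun _ => (0 : ℝ)) u s' hus
    (fun τ _ => hasDerivAt_const τ (1 : ℝ)) continuousOn_const q p₀
  simp only [smul_zero, NormedSpace.exp_zero, Matrix.mul_one, Complex.ofReal_one, one_mul,
    Complex.ofReal_zero, zero_smul, add_zero, one_smul, zero_sub] at h
  rw [Matrix.sub_apply, ← neg_sub, h, ← intervalIntegral.integral_neg]
  refine intervalIntegral.integral_congr fun τ _ => ?_
  simp only [Matrix.neg_mul, Matrix.neg_apply, neg_neg]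

/-- **Time-Lipschitz modulus of the weighted free column.**  If the time derivative of the free column has the profile
`‖(H_1K_1(τ))((z,b,β),p₀)‖ ≤ C_T/(1+τ+d(x,z)²)³` for `τ ∈ [u, s']` and the weighted moment
`Σ_z (d+3)²((1+τ)/(1+τ+d²)³)² ≤ M/(1+τ)` holds, then for `0 ≤ u ≤ s'`
`√(Σ_q (d(x,q)+3)² ‖(K_1(u) − K_1(s'))(q,p₀)‖²) ≤ (s' − u) · √(12 C_T² M)/((1+u)√(1+u))`. -/
theorem weighted_free_col_diff_le (B : Matrix (TorusSite 4 L × Fin 3 × Fin 4) (TorusSite 4 L × Fin 3 × Fin 4) ℂ)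
    (x : TorusSite 4 L) (p₀ : TorusSite 4 L × Fin 3 × Fin 4) {C_T M u s' : ℝ}
    (hu : 0 ≤ u) (hus : u ≤ s')
    (hT : ∀ τ, u ≤ τ → τ ≤ s' → ∀ (z : TorusSite 4 L) (b : Fin 3) (β : Fin 4),
      ‖((Bᴴ * B) * NormedSpace.exp (-(τ : ℂ) • (Bᴴ * B))) (z, b, β) p₀‖ ≤ C_T / (1 + τ + (torusDist x z : ℝ) ^ 2) ^ 3)
    (hM : ∀ τ, 0 ≤ τ → ∑ z : TorusSite 4 L, ((torusDist x z : ℝ) + 3) ^ 2 *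
      ((1 + τ) / (1 + τ + (torusDist x z : ℝ) ^ 2) ^ 3) ^ 2 ≤ M / (1 + τ)) :
    Real.sqrt (∑ q : TorusSite 4 L × Fin 3 × Fin 4, ((torusDist x q.1 : ℝ) + 3) ^ 2 *
        ‖(NormedSpace.exp (-(u : ℂ) • (Bᴴ * B)) - NormedSpace.exp (-(s' : ℂ) • (Bᴴ * B))) q p₀‖ ^ 2) ≤
      (s' - u) * (Real.sqrt (12 * C_T ^ 2 * M) / ((1 + u) * Real.sqrt (1 + u))) := by
  set H : Matrix _ _ ℂ := Bᴴ * B with hH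
  -- the weighted difference as an interval integral
  let w : (TorusSite 4 L × Fin 3 × Fin 4) → ℂ := fun q =>
    (((torusDist x q.1 : ℝ) + 3 : ℝ) : ℂ) * (NormedSpace.exp (-(u : ℂ) • H) - NormedSpace.exp (-(s' : ℂ) • H)) q p₀
  let G : ℝ → (TorusSite 4 L × Fin 3 × Fin 4) → ℂ := fun τ q =>
    (((torusDist x q.1 : ℝ) + 3 : ℝ) : ℂ) * ((H * NormedSpace.exp (-(τ : ℂ) • H)) q p₀)
  have hw : ∀ q, w q = ∫ τ in u..s', G τ q := fun q => by
    show (((torusDist x q.1 : ℝ) + 3 : ℝ) : ℂ) * _ = ∫ τ in u..s', (((torusDist x q.1 : ℝ) + 3 : ℝ) : ℂ) * _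
    rw [intervalIntegral.integral_const_mul, free_col_diff_eq_integral B hus q p₀]
  have hGcont : ∀ q, ContinuousOn (fun τ => G τ q) (Set.Icc u s') := by
    intro q
    have h := rowDuhamel_continuousOn_entry (0 : Matrix _ _ ℂ) H H s' (θ := fun _ => (0 : ℝ)) (θ' := fun _ => (1 : ℝ))
      (S := Set.Icc u s') continuousOn_const continuousOn_const q p₀
    have h' : ContinuousOn (fun τ : ℝ => (H * NormedSpace.exp (-(τ : ℂ) • H)) q p₀) (Set.Icc u s') := by
      refine h.congr fun τ _ => ?_
      simp only [smul_zero, NormedSpace.exp_zero, Matrix.one_mul, Complex.ofReal_one, one_smul,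
        Complex.ofReal_zero, zero_smul, zero_add]
    exact continuousOn_const.mul h'
  -- the norm of the weighted difference equals the weighted sum
  have hnorm : ∀ q : TorusSite 4 L × Fin 3 × Fin 4, ((torusDist x q.1 : ℝ) + 3) ^ 2 *
      ‖(NormedSpace.exp (-(u : ℂ) • H) - NormedSpace.exp (-(s' : ℂ) • H)) q p₀‖ ^ 2 = ‖w q‖ ^ 2 := by
    intro q
    show _ = ‖(((torusDist x q.1 : ℝ) + 3 : ℝ) : ℂ) * _‖ ^ 2
    rw [norm_mul, Complex.norm_real, Real.norm_eq_abs, abs_of_nonneg (by positivity), mul_pow]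
  simp only [hnorm]
  -- pointwise bound of the integrand by a constant
  set Λ : ℝ := Real.sqrt (12 * C_T ^ 2 * M) / ((1 + u) * Real.sqrt (1 + u)) with hΛ
  have h1u : 0 < 1 + u := by linarith
  have hbound : ∀ τ ∈ Set.Icc u s', Real.sqrt (∑ q, ‖G τ q‖ ^ 2) ≤ Λ := by
    intro τ hτ
    have h1τ : 0 < 1 + τ := by linarith [hτ.1]
    have hGq : ∀ q, ‖G τ q‖ ^ 2 = ((torusDist x q.1 : ℝ) + 3) ^ 2 * ‖(H * NormedSpace.exp (-(τ : ℂ) • H)) q p₀‖ ^ 2 := by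
      intro q
      show ‖(((torusDist x q.1 : ℝ) + 3 : ℝ) : ℂ) * _‖ ^ 2 = _
      rw [norm_mul, Complex.norm_real, Real.norm_eq_abs, abs_of_nonneg (by positivity), mul_pow]
    simp only [hGq]
    have hw0 : ∀ z : TorusSite 4 L, 0 ≤ ((torusDist x z : ℝ) + 3) ^ 2 := fun z => by positivity
    have hprof := sum_weight_norm_sq_le_of_profile (fun q => (H * NormedSpace.exp (-(τ : ℂ) • H)) q p₀)
      (fun z => ((torusDist x z : ℝ) + 3) ^ 2) (fun z => 1 / (1 + τ + (torusDist x z : ℝ) ^ 2) ^ 3) hw0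
      (fun z b β => by rw [mul_one_div]; exact hT τ hτ.1 hτ.2 z b β)
    have hmom : ∑ z : TorusSite 4 L, ((torusDist x z : ℝ) + 3) ^ 2 * (1 / (1 + τ + (torusDist x z : ℝ) ^ 2) ^ 3) ^ 2 ≤
        M / (1 + τ) ^ 3 := by
      have hre : ∀ z : TorusSite 4 L, ((torusDist x z : ℝ) + 3) ^ 2 * (1 / (1 + τ + (torusDist x z : ℝ) ^ 2) ^ 3) ^ 2 =
          (1 / (1 + τ) ^ 2) * (((torusDist x z : ℝ) + 3) ^ 2 *
            ((1 + τ) / (1 + τ + (torusDist x z : ℝ) ^ 2) ^ 3) ^ 2) := by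
        intro z
        field_simp
      rw [Finset.sum_congr rfl fun z _ => hre z, ← Finset.mul_sum]
      calc 1 / (1 + τ) ^ 2 * ∑ z : TorusSite 4 L, ((torusDist x z : ℝ) + 3) ^ 2 *
            ((1 + τ) / (1 + τ + (torusDist x z : ℝ) ^ 2) ^ 3) ^ 2
          ≤ 1 / (1 + τ) ^ 2 * (M / (1 + τ)) := mul_le_mul_of_nonneg_left (hM τ (by linarith [hτ.1])) (by positivity)
        _ = M / (1 + τ) ^ 3 := by field_simp
    have hkey : ∑ q : TorusSite 4 L × Fin 3 × Fin 4, ((torusDist x q.1 : ℝ) + 3) ^ 2 *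
        ‖(H * NormedSpace.exp (-(τ : ℂ) • H)) q p₀‖ ^ 2 ≤ 12 * C_T ^ 2 * (M / (1 + τ) ^ 3) :=
      hprof.trans (mul_le_mul_of_nonneg_left hmom (by positivity))
    calc Real.sqrt (∑ q : TorusSite 4 L × Fin 3 × Fin 4, ((torusDist x q.1 : ℝ) + 3) ^ 2 *
          ‖(H * NormedSpace.exp (-(τ : ℂ) • H)) q p₀‖ ^ 2)
        ≤ Real.sqrt (12 * C_T ^ 2 * (M / (1 + τ) ^ 3)) := Real.sqrt_le_sqrt hkey
      _ = Real.sqrt (12 * C_T ^ 2 * M) / ((1 + τ) * Real.sqrt (1 + τ)) := by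
          rw [show 12 * C_T ^ 2 * (M / (1 + τ) ^ 3) = 12 * C_T ^ 2 * M / ((1 + τ) ^ 2 * (1 + τ)) by ring,
            Real.sqrt_div' _ (by positivity), Real.sqrt_mul (sq_nonneg (1 + τ)), Real.sqrt_sq h1τ.le]
      _ ≤ Λ := by
          rw [hΛ]
          refine div_le_div_of_nonneg_left (Real.sqrt_nonneg _) (by positivity) ?_
          exact mul_le_mul (by linarith [hτ.1]) (Real.sqrt_le_sqrt (by linarith [hτ.1])) (Real.sqrt_nonneg _) h1τ.le
  have hdual := sqrt_sum_norm_sq_le_integral_of_forall_le w G (fun _ => Λ) hus hGcont continuousOn_const hw hbound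
  refine hdual.trans (le_of_eq ?_)
  rw [intervalIntegral.integral_const, smul_eq_mul]


/-! ### The `ℓ¹` vertex bound and the Lipschitz modulus, packaged -/

/-- **The `ℓ¹` bound of the second vertex**: in a linear link-deficit profile centred at `x`,
`Σ_q ‖(EᴴD_1K_1(σ)e_{(x,a,α)})_q‖ ≤ δ A₂` for `0 ≤ σ ≤ L²` (landed hopping bound (3), free `D_1`-profile, third moment). -/
theorem hopping_col_l1_bound {C_A : ℝ} (hCA : 0 ≤ C_A) :
    ∃ A₂ : ℝ, 0 ≤ A₂ ∧ ∀ (L : ℕ) [NeZero L] (W : GaugeConfig 4 L SU3) (m : ℝ), m ∈ Set.Icc (-(1 / 2 : ℝ)) 1 →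
      ∀ (x : TorusSite 4 L) (δ : ℝ), 0 ≤ δ →
      (∀ (z : TorusSite 4 L) (μ : Fin 4),
        3 - ((fundamentalRep (Fin 3)) (W (z, μ))).trace.re ≤ C_A * ((torusDist x z : ℝ) + 1) ^ 2 * δ ^ 2) →
      ∀ σ : ℝ, 0 ≤ σ → σ ≤ (L : ℝ) ^ 2 → ∀ (a : Fin 3) (α : Fin 4),
        ∑ q, ‖((wilsonDirac (fundamentalRep (Fin 3)) W m 1 - wilsonDirac (fundamentalRep (Fin 3)) (freeCfg L) m 1)ᴴ.mulVec
            ((wilsonDirac (fundamentalRep (Fin 3)) (freeCfg L) m 1).mulVec fun k =>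
              (NormedSpace.exp (-(σ : ℂ) • ((wilsonDirac (fundamentalRep (Fin 3)) (freeCfg L) m 1)ᴴ *
                wilsonDirac (fundamentalRep (Fin 3)) (freeCfg L) m 1))) k (x, a, α))) q‖ ≤ δ * A₂ := by
  obtain ⟨C_H0, hH0⟩ := stub_hoppingWeightedBounds C_A hCA
  obtain ⟨C_F0, c_F, hcF, hF0⟩ := stub_freeColumnProfile
  obtain ⟨M0, hM0⟩ := stub_freeWeightedMoments
  set C_H : ℝ := max C_H0 0 with hCH
  set C_F : ℝ := max C_F0 0 with hCF
  set M : ℝ := max M0 0 with hMdef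
  have hCH0 : 0 ≤ C_H := le_max_right _ _
  have hCF0 : 0 ≤ C_F := le_max_right _ _
  have hM00 : 0 ≤ M := le_max_right _ _
  refine ⟨C_H * (12 * C_F * M), by positivity, ?_⟩
  intro L _ W m hm x δ hδ0 hprof σ hσ0 hσL a α
  set D₁ : Matrix (TorusSite 4 L × Fin 3 × Fin 4) (TorusSite 4 L × Fin 3 × Fin 4) ℂ :=
    wilsonDirac (fundamentalRep (Fin 3)) (freeCfg L) m 1 with hD₁
  set col : (TorusSite 4 L × Fin 3 × Fin 4) → ℂ := fun k => (NormedSpace.exp (-(σ : ℂ) • (D₁ᴴ * D₁))) k (x, a, α)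
    with hcol
  have hprofile : ∀ z b β,
      ‖(D₁.mulVec col) (z, b, β)‖ ≤ C_F * (Real.sqrt (1 + σ) / (1 + σ + (torusDist x z : ℝ) ^ 2) ^ 3) := by
    intro z b β
    have h := (hF0 L m hm σ hσ0 hσL x z a b α β).2
    have hmv : (D₁.mulVec col) (z, b, β) = (D₁ * NormedSpace.exp (-(σ : ℂ) • (D₁ᴴ * D₁))) (z, b, β) (x, a, α) :=
      (mul_apply_eq_mulVec D₁ _ _ _).symm
    rw [hmv]
    refine h.trans ?_
    rw [mul_div_assoc]
    have hexp : Real.exp (-(c_F * σ * m ^ 2)) ≤ 1 := by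
      rw [Real.exp_le_one_iff]
      have : 0 ≤ c_F * σ * m ^ 2 := by have := hcF.le; positivity
      linarith
    have h1 : C_F0 * Real.exp (-(c_F * σ * m ^ 2)) ≤ C_F * 1 := by
      rcases le_or_gt 0 C_F0 with hc | hc
      · exact mul_le_mul (le_max_left _ _) hexp (Real.exp_pos _).le hCF0
      · exact (mul_nonpos_of_nonpos_of_nonneg hc.le (Real.exp_pos _).le |>.trans (by positivity))
    have hq : 0 ≤ Real.sqrt (1 + σ) / (1 + σ + (torusDist x z : ℝ) ^ 2) ^ 3 := by positivity
    calc C_F0 * Real.exp (-(c_F * σ * m ^ 2)) * (Real.sqrt (1 + σ) / (1 + σ + (torusDist x z : ℝ) ^ 2) ^ 3)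
        ≤ C_F * 1 * (Real.sqrt (1 + σ) / (1 + σ + (torusDist x z : ℝ) ^ 2) ^ 3) := mul_le_mul_of_nonneg_right h1 hq
      _ = _ := by rw [mul_one]
  have hw1 : ∀ z : TorusSite 4 L, 0 ≤ ((torusDist x z : ℝ) + 3) := fun z => by positivity
  have hmomC : ∑ q : TorusSite 4 L × Fin 3 × Fin 4, ((torusDist x q.1 : ℝ) + 3) * ‖(D₁.mulVec col) q‖ ≤ 12 * C_F * M := by
    refine (sum_weight_norm_le_of_profile (D₁.mulVec col) (fun z => ((torusDist x z : ℝ) + 3))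
      (fun z => Real.sqrt (1 + σ) / (1 + σ + (torusDist x z : ℝ) ^ 2) ^ 3) hw1 hprofile).trans ?_
    exact mul_le_mul_of_nonneg_left (((hM0 L x σ hσ0).2.2).trans (le_max_left _ _)) (by positivity)
  have h1 := ((hH0 L W m x δ hδ0 hprof) (D₁.mulVec col)).2.2
  have hS0 : 0 ≤ ∑ q : TorusSite 4 L × Fin 3 × Fin 4, ((torusDist x q.1 : ℝ) + 3) * ‖(D₁.mulVec col) q‖ :=
    Finset.sum_nonneg fun q _ => by positivity
  calc ∑ q, ‖((wilsonDirac (fundamentalRep (Fin 3)) W m 1 - D₁)ᴴ.mulVec (D₁.mulVec col)) q‖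
      ≤ C_H0 * δ * ∑ q, ((torusDist x q.1 : ℝ) + 3) * ‖(D₁.mulVec col) q‖ := h1
    _ ≤ C_H * δ * ∑ q, ((torusDist x q.1 : ℝ) + 3) * ‖(D₁.mulVec col) q‖ :=
        mul_le_mul_of_nonneg_right (mul_le_mul_of_nonneg_right (le_max_left _ _) hδ0) hS0
    _ ≤ C_H * δ * (12 * C_F * M) := mul_le_mul_of_nonneg_left hmomC (by positivity)
    _ = δ * (C_H * (12 * C_F * M)) := by ring

/-- **The time-Lipschitz modulus of `u ↦ E K_1(u) e` on the late half `[s/2, s]`**: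
`‖E(K_1(u) − K_1(s))e_{(x,a,α)}‖₂ ≤ δA₃ (s − u)/((1+s/2)√(1+s/2))` for `0 ≤ s ≤ L²` in a linear link-deficit profile
(landed hopping bound (1) + `weighted_free_col_diff_le` fed with the landed free time-derivative profile and moments). -/
theorem hopping_col_lipschitz {C_A : ℝ} (hCA : 0 ≤ C_A) :
    ∃ A₃ : ℝ, 0 ≤ A₃ ∧ ∀ (L : ℕ) [NeZero L] (W : GaugeConfig 4 L SU3) (m : ℝ), m ∈ Set.Icc (-(1 / 2 : ℝ)) 1 →
      ∀ (x : TorusSite 4 L) (δ : ℝ), 0 ≤ δ →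
      (∀ (z : TorusSite 4 L) (μ : Fin 4),
        3 - ((fundamentalRep (Fin 3)) (W (z, μ))).trace.re ≤ C_A * ((torusDist x z : ℝ) + 1) ^ 2 * δ ^ 2) →
      ∀ s : ℝ, 0 ≤ s → s ≤ (L : ℝ) ^ 2 → ∀ (a : Fin 3) (α : Fin 4), ∀ u ∈ Set.Icc (s / 2) s,
        Real.sqrt (∑ q, ‖((wilsonDirac (fundamentalRep (Fin 3)) W m 1 - wilsonDirac (fundamentalRep (Fin 3)) (freeCfg L) m 1).mulVec
              (fun k => (NormedSpace.exp (-(u : ℂ) • ((wilsonDirac (fundamentalRep (Fin 3)) (freeCfg L) m 1)ᴴ *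
                wilsonDirac (fundamentalRep (Fin 3)) (freeCfg L) m 1))) k (x, a, α))) q -
            ((wilsonDirac (fundamentalRep (Fin 3)) W m 1 - wilsonDirac (fundamentalRep (Fin 3)) (freeCfg L) m 1).mulVec
              (fun k => (NormedSpace.exp (-(s : ℂ) • ((wilsonDirac (fundamentalRep (Fin 3)) (freeCfg L) m 1)ᴴ *
                wilsonDirac (fundamentalRep (Fin 3)) (freeCfg L) m 1))) k (x, a, α))) q‖ ^ 2) ≤
          δ * A₃ / ((1 + s / 2) * Real.sqrt (1 + s / 2)) * (s - u) := by
  obtain ⟨C_H0, hH0⟩ := stub_hoppingWeightedBounds C_A hCA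
  obtain ⟨M0, hM0⟩ := stub_freeWeightedMoments
  obtain ⟨C_T0, c_T, hcT, hT0⟩ := stub_freeTimeDerivativeProfile
  set C_H : ℝ := max C_H0 0 with hCH
  set M : ℝ := max M0 0 with hMdef
  set C_T : ℝ := max C_T0 0 with hCT
  have hCH0 : 0 ≤ C_H := le_max_right _ _
  have hM00 : 0 ≤ M := le_max_right _ _
  have hCT0 : 0 ≤ C_T := le_max_right _ _
  refine ⟨Real.sqrt C_H * Real.sqrt (12 * C_T ^ 2 * M), by positivity, ?_⟩
  intro L _ W m hm x δ hδ0 hprof s hs0 hsL a α u hu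
  set D : Matrix (TorusSite 4 L × Fin 3 × Fin 4) (TorusSite 4 L × Fin 3 × Fin 4) ℂ :=
    wilsonDirac (fundamentalRep (Fin 3)) W m 1 with hD
  set D₁ : Matrix (TorusSite 4 L × Fin 3 × Fin 4) (TorusSite 4 L × Fin 3 × Fin 4) ℂ :=
    wilsonDirac (fundamentalRep (Fin 3)) (freeCfg L) m 1 with hD₁
  set p₀ : TorusSite 4 L × Fin 3 × Fin 4 := (x, a, α) with hp₀
  let K₁ : ℝ → Matrix _ _ ℂ := fun τ => NormedSpace.exp (-(τ : ℂ) • (D₁ᴴ * D₁))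
  have hu0 : 0 ≤ u := by linarith [hu.1]
  have hdiff : ∀ q, ((D - D₁).mulVec (fun k => K₁ u k p₀)) q - ((D - D₁).mulVec (fun k => K₁ s k p₀)) q =
      ((D - D₁).mulVec (fun q' => (K₁ u - K₁ s) q' p₀)) q := by
    intro q
    rw [← Pi.sub_apply, ← Matrix.mulVec_sub]
    rfl
  show Real.sqrt (∑ q, ‖((D - D₁).mulVec (fun k => K₁ u k p₀)) q - ((D - D₁).mulVec (fun k => K₁ s k p₀)) q‖ ^ 2) ≤ _
  simp only [hdiff]
  have h1 := ((hH0 L W m x δ hδ0 hprof) (fun q' => (K₁ u - K₁ s) q' p₀)).1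
  have hW := weighted_free_col_diff_le D₁ x p₀ (C_T := C_T) (M := M) hu0 hu.2
    (fun τ hτu hτs z b β => by
      have h := hT0 L m hm τ (hu0.trans hτu) (hτs.trans hsL) x z a b α β
      refine h.trans ?_
      have hτ0 : 0 ≤ τ := hu0.trans hτu
      have hexp : Real.exp (-(c_T * τ * m ^ 2)) ≤ 1 := by
        rw [Real.exp_le_one_iff]
        have : 0 ≤ c_T * τ * m ^ 2 := by have := hcT.le; positivity
        linarith
      have hden : 0 < (1 + τ + (torusDist x z : ℝ) ^ 2) ^ 3 := by positivity
      refine div_le_div_of_nonneg_right ?_ hden.le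
      rcases le_or_gt 0 C_T0 with hc | hc
      · exact (mul_le_mul (le_max_left _ _) hexp (Real.exp_pos _).le hCT0).trans (le_of_eq (mul_one _))
      · exact (mul_nonpos_of_nonpos_of_nonneg hc.le (Real.exp_pos _).le).trans hCT0)
    (fun τ hτ0 => ((hM0 L x τ hτ0).1).trans (div_le_div_of_nonneg_right (le_max_left _ _) (by linarith)))
  have hS0 : 0 ≤ ∑ q : TorusSite 4 L × Fin 3 × Fin 4,
      ((torusDist x q.1 : ℝ) + 3) ^ 2 * ‖(K₁ u - K₁ s) q p₀‖ ^ 2 := Finset.sum_nonneg fun q _ => by positivity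
  have h2 : ∑ q, ‖((D - D₁).mulVec (fun q' => (K₁ u - K₁ s) q' p₀)) q‖ ^ 2 ≤
      C_H * δ ^ 2 * ∑ q : TorusSite 4 L × Fin 3 × Fin 4, ((torusDist x q.1 : ℝ) + 3) ^ 2 * ‖(K₁ u - K₁ s) q p₀‖ ^ 2 :=
    h1.trans (mul_le_mul_of_nonneg_right (mul_le_mul_of_nonneg_right (le_max_left _ _) (sq_nonneg _)) hS0)
  calc Real.sqrt (∑ q, ‖((D - D₁).mulVec (fun q' => (K₁ u - K₁ s) q' p₀)) q‖ ^ 2)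
      ≤ Real.sqrt (C_H * δ ^ 2 * ∑ q : TorusSite 4 L × Fin 3 × Fin 4,
          ((torusDist x q.1 : ℝ) + 3) ^ 2 * ‖(K₁ u - K₁ s) q p₀‖ ^ 2) := Real.sqrt_le_sqrt h2
    _ = Real.sqrt C_H * δ * Real.sqrt (∑ q : TorusSite 4 L × Fin 3 × Fin 4,
          ((torusDist x q.1 : ℝ) + 3) ^ 2 * ‖(K₁ u - K₁ s) q p₀‖ ^ 2) := by
        rw [Real.sqrt_mul (by positivity), Real.sqrt_mul hCH0, Real.sqrt_sq hδ0]
    _ ≤ Real.sqrt C_H * δ * ((s - u) * (Real.sqrt (12 * C_T ^ 2 * M) / ((1 + u) * Real.sqrt (1 + u)))) :=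
        mul_le_mul_of_nonneg_left hW (by positivity)
    _ ≤ Real.sqrt C_H * δ * ((s - u) * (Real.sqrt (12 * C_T ^ 2 * M) / ((1 + s / 2) * Real.sqrt (1 + s / 2)))) := by
        refine mul_le_mul_of_nonneg_left (mul_le_mul_of_nonneg_left ?_ (by linarith [hu.2])) (by positivity)
        refine div_le_div_of_nonneg_left (Real.sqrt_nonneg _) (by positivity) ?_
        exact mul_le_mul (by linarith [hu.1]) (Real.sqrt_le_sqrt (by linarith [hu.1])) (Real.sqrt_nonneg _) (by linarith)
    _ = δ * (Real.sqrt C_H * Real.sqrt (12 * C_T ^ 2 * M)) / ((1 + s / 2) * Real.sqrt (1 + s / 2)) * (s - u) := by ring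

/-! ### One Dirac factor on the interacting kernel, `ℓ¹ → ℓ²` -/

/-- **Column size of `D_W K_W(σ)`** under global smallness: `‖D_W K_W(σ) e_q‖₂ ≤ √(C₉/(eσ³))` for `1 ≤ σ ≤ r²` — the
spectral gain `Σ_i‖(DK(σ))(i,q)‖² ≤ (eσ)⁻¹ Re K(σ)(q,q)` (`sum_norm_sq_col_mul_exp_le`) and the closed crux 8871 at the site
of `q`. -/
theorem deriv_col_sup :
    ∃ ε₈ : ℝ, 0 < ε₈ ∧ ∃ C₉ : ℝ, 0 ≤ C₉ ∧ ∀ (L : ℕ) [NeZero L] (W : GaugeConfig 4 L SU3) (m : ℝ), m ∈ Set.Icc (-(1 / 2 : ℝ)) 1 →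
      ∀ (r : ℕ), 1 ≤ r → r ≤ L → ∀ (ε : ℝ), 0 < ε → ε ≤ ε₈ →
      (∀ (y : TorusSite 4 L) (μ ν : Fin 4),
        3 - ((fundamentalRep (Fin 3)) (plaquetteHolonomy W y μ ν)).trace.re ≤ (ε / (r : ℝ) ^ 2) ^ 2) →
      ∀ σ : ℝ, 1 ≤ σ → σ ≤ (r : ℝ) ^ 2 → ∀ q : TorusSite 4 L × Fin 3 × Fin 4,
        Real.sqrt (∑ i, ‖(wilsonDirac (fundamentalRep (Fin 3)) W m 1 *
            NormedSpace.exp (-(σ : ℂ) • ((wilsonDirac (fundamentalRep (Fin 3)) W m 1)ᴴ *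
              wilsonDirac (fundamentalRep (Fin 3)) W m 1))) i q‖ ^ 2) ≤ Real.sqrt (C₉ / (Real.exp 1 * σ ^ 3)) := by
  obtain ⟨ε₈, hε₈, K₈, C₈, hSFU⟩ :=
    (Cruxes.SmallFieldUltracontractivity.PointCentredAxialParabolic.SmallFieldUltracontractivity_of :
      SmallFieldUltracontractivity)
  refine ⟨ε₈, hε₈, max C₈ 0, le_max_right _ _, ?_⟩
  intro L _ W m hm r hr hrL ε hε hεε₈ hsmall σ h1 h2 q
  set D : Matrix (TorusSite 4 L × Fin 3 × Fin 4) (TorusSite 4 L × Fin 3 × Fin 4) ℂ :=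
    wilsonDirac (fundamentalRep (Fin 3)) W m 1 with hD
  have hr0 : (0 : ℝ) < (r : ℝ) := by exact_mod_cast (Nat.lt_of_lt_of_le Nat.zero_lt_one hr)
  have hr2 : (0 : ℝ) < (r : ℝ) ^ 2 := by positivity
  have hσ0 : 0 < σ := by linarith
  have hspec := sum_norm_sq_col_mul_exp_le D hσ0 q
  obtain ⟨y, b, β⟩ := q
  have hsfu := hSFU L W m hm y r hr hrL (fun y' _ μ ν => (hsmall y' μ ν).trans (by
    have h1' : 0 ≤ ε / (r : ℝ) ^ 2 := div_nonneg hε.le hr2.le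
    exact pow_le_pow_left₀ h1' (div_le_div_of_nonneg_right hεε₈ hr2.le) 2)) σ h1 h2 b b β β
  have hre' : ((NormedSpace.exp (-(σ : ℂ) • (Dᴴ * D))) (y, b, β) (y, b, β)).re ≤ C₈ / σ ^ 2 :=
    (Complex.re_le_norm _).trans (by exact_mod_cast hsfu)
  have hre : ((NormedSpace.exp (-(σ : ℂ) • (Dᴴ * D))) (y, b, β) (y, b, β)).re ≤ max C₈ 0 / σ ^ 2 :=
    hre'.trans (div_le_div_of_nonneg_right (le_max_left _ _) (by positivity))
  refine Real.sqrt_le_sqrt (hspec.trans ?_)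
  calc (Real.exp 1 * σ)⁻¹ * ((NormedSpace.exp (-(σ : ℂ) • (Dᴴ * D))) (y, b, β) (y, b, β)).re
      ≤ (Real.exp 1 * σ)⁻¹ * (max C₈ 0 / σ ^ 2) := mul_le_mul_of_nonneg_left hre (by positivity)
    _ = max C₈ 0 / (Real.exp 1 * σ ^ 3) := by
        have hσne : σ ≠ 0 := hσ0.ne'
        field_simp

/-- **Registered form (stub `stub_derivativeColumnAuxB` of the crux item)**: the `ℓ¹ → ℓ²` column size of one Dirac factor
on the interacting kernel under global smallness (`deriv_col_sup`), the registered handle under which this helper file lands. -/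
theorem stub_derivativeColumnAuxB :
    ∃ ε₈ : ℝ, 0 < ε₈ ∧ ∃ C₉ : ℝ, 0 ≤ C₉ ∧ ∀ (L : ℕ) [NeZero L] (W : GaugeConfig 4 L SU3) (m : ℝ), m ∈ Set.Icc (-(1 / 2 : ℝ)) 1 →
      ∀ (r : ℕ), 1 ≤ r → r ≤ L → ∀ (ε : ℝ), 0 < ε → ε ≤ ε₈ →
      (∀ (y : TorusSite 4 L) (μ ν : Fin 4),
        3 - ((fundamentalRep (Fin 3)) (plaquetteHolonomy W y μ ν)).trace.re ≤ (ε / (r : ℝ) ^ 2) ^ 2) →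
      ∀ σ : ℝ, 1 ≤ σ → σ ≤ (r : ℝ) ^ 2 → ∀ q : TorusSite 4 L × Fin 3 × Fin 4,
        Real.sqrt (∑ i, ‖(wilsonDirac (fundamentalRep (Fin 3)) W m 1 *
            NormedSpace.exp (-(σ : ℂ) • ((wilsonDirac (fundamentalRep (Fin 3)) W m 1)ᴴ *
              wilsonDirac (fundamentalRep (Fin 3)) W m 1))) i q‖ ^ 2) ≤ Real.sqrt (C₉ / (Real.exp 1 * σ ^ 3)) :=
  deriv_col_sup

end Summit.QuantumFields.QCD.Cruxes.TracedQuadraticParametrix.Sketch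

end
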